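import Mathlib
import Summits.Ventures.PercRepro2.Defs
import Summits.Ventures.PercRepro2.Harris
import Summits.Ventures.PercRepro2.Graph
import Summits.Ventures.PercRepro2.Induced
import Summits.Ventures.PercRepro2.WForm
import Summits.Ventures.PercRepro2.WStatus
import Summits.Ventures.PercRepro2.WAltDefs
import Summits.Ventures.PercRepro2.WAltTheorem
import Summits.Ventures.PercRepro2.WStatusDict
import Summits.Ventures.PercRepro2.WAll

/-!
# Positive association of the disjointness-conditioned copy (blind cell PercRepro2, mine-1 g15;
proofs/MINE1-W-THEOREM.md §7 (a))

The heart of the alternating argument is not the W-form itself but the statement behind its four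
terms: **the marginal of either copy under the two-copy law conditioned on `F`-disjointness (and
`T`-avoidance) is positively associated.** Abstractly (`WForm.marginal_pa`): under the hypotheses of
`Q_nonneg_of_alternating`, for monotone `f, g`,
`(∑_t q t f t g t) · (∑_t q t) ≥ (∑_t q t f t) · (∑_t q t g t)`, `q t = W t · Z t`.
For the status law (`statusPA_of_disjoint`): with `W_S = P(C(s) ∩ F = S, C(s) ∩ T = ∅)` and
`Z_S = P(C(s) avoids T ∪ (S ∩ F))` (= the probability that an independent copy is `F`-disjoint
from `S` and avoids `T`), so that `q_S = W_S Z_S = P(S₁ = S, 𝒟)` for two independent copies and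
`𝒟 = {S₁ ∩ S₂ = ∅, both avoid T}`:
`E[f(S₁) g(S₁); 𝒟] · P(𝒟) ≥ E[f(S₁); 𝒟] · E[g(S₁); 𝒟]` for all monotone `f, g : Finset V → R`.
(Positive association survives conditioning on disjointness from an independent copy; the
W-inequality `wIneqStatus_all` is its cross-copy shadow.)
-/

namespace Summit.Ventures.PercRepro2.WForm

section MarginalPA

variable {R : Type*} [Field R] [LinearOrder R] [IsStrictOrderedRing R]
variable {α : Type*} [Fintype α] [DecidableEq α] [Preorder α]
variable {D : α → α → Prop} [DecidableRel D] {W : α → R}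

/-- **Positive association of the marginal**: under the hypotheses of the alternating theorem,
`(∑ q f g) (∑ q) ≥ (∑ q f) (∑ q g)` for monotone `f, g`. -/
theorem marginal_pa [Archimedean R] (hW : ∀ s, 0 ≤ W s)
    (hD : ∀ s t, D s t → D t s) (hD1 : ∀ s s' t, s ≤ s' → D s' t → D s t)
    (t₀ : α) (hD0 : ∀ t, D t₀ t) (h0 : 0 < W t₀) (hH1 : CondPA D W)
    {f g : α → R} (hf : Monotone f) (hg : Monotone g) :
    (∑ t, q D W t * f t) * (∑ t, q D W t * g t) ≤
      (∑ t, q D W t * (f t * g t)) * (∑ t, q D W t) := by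
  have hD2 : ∀ s t t', t ≤ t' → D s t' → D s t := fun s t t' htt' h' =>
    hD t s (hD1 t t' s htt' (hD s t' h'))
  have hZ : ∀ t, 0 < Z D W t := fun t => Z_pos hW (hD0 t) h0
  have hM : 0 < ∑ t, q D W t := by
    refine lt_of_lt_of_le (mul_pos h0 (hZ t₀)) ?_
    exact Finset.single_le_sum (f := fun t => q D W t) (fun t _ => q_nonneg hW t) (Finset.mem_univ t₀)
  set M : R := ∑ t, q D W t with hMdef
  -- centre
  set f₀ : α → R := fun t => f t - (∑ t, q D W t * f t) / M with hf₀
  set g₀ : α → R := fun t => g t - (∑ t, q D W t * g t) / M with hg₀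
  have hf₀m : Monotone f₀ := fun a b hab => by simp only [hf₀]; linarith [hf hab]
  have hg₀m : Monotone g₀ := fun a b hab => by simp only [hg₀]; linarith [hg hab]
  have hST : SameType f₀ g₀ := Or.inl ⟨hf₀m, hg₀m⟩
  have hf₀0 : ∑ t, q D W t * f₀ t = 0 := by
    simp only [hf₀, mul_sub, Finset.sum_sub_distrib, ← Finset.sum_mul]
    rw [← hMdef, mul_div_cancel₀ _ hM.ne', sub_self]
  have hg₀0 : ∑ t, q D W t * g₀ t = 0 := by
    simp only [hg₀, mul_sub, Finset.sum_sub_distrib, ← Finset.sum_mul]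
    rw [← hMdef, mul_div_cancel₀ _ hM.ne', sub_self]
  -- the centred pair sum is the (cleared) covariance
  have hcov : pairSum D W f₀ g₀ * M =
      (∑ t, q D W t * (f t * g t)) * M - (∑ t, q D W t * f t) * (∑ t, q D W t * g t) := by
    unfold pairSum
    simp only [hf₀, hg₀]
    have e : ∀ t, q D W t * ((f t - (∑ t, q D W t * f t) / M) * (g t - (∑ t, q D W t * g t) / M)) =
        q D W t * (f t * g t) - q D W t * f t * ((∑ t, q D W t * g t) / M)
          - q D W t * g t * ((∑ t, q D W t * f t) / M)
          + q D W t * (((∑ t, q D W t * f t) / M) * ((∑ t, q D W t * g t) / M)) := by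
      intro t; ring
    simp only [e, Finset.sum_add_distrib, Finset.sum_sub_distrib, ← Finset.sum_mul]
    field_simp
    ring
  -- the chain bound for the centred pair
  have key : ∀ n : ℕ,
      -(M * ((hi t₀ f₀ - lo t₀ f₀) * (hi t₀ g₀ - lo t₀ g₀)) * (1 - eps W t₀) ^ n) ≤
        pairSum D W f₀ g₀ := by
    intro n
    have h1 := pairSum_iterate_le hW hD hD1 hD2 hZ hH1 hST n
    have hfn : ∑ t, q D W t * (K D W)^[n] f₀ t = 0 := by rw [sum_q_mul_iterate hD hZ, hf₀0]
    have hgn : ∑ t, q D W t * (K D W)^[n] g₀ t = 0 := by rw [sum_q_mul_iterate hD hZ, hg₀0]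
    have h2 := neg_le_pairSum hW t₀ hM hfn hgn
    have oF := osc_iterate_le hW hD0 h0 f₀ n
    have oG := osc_iterate_le hW hD0 h0 g₀ n
    have hr0 : 0 ≤ (1 - eps W t₀) ^ n := pow_nonneg (sub_nonneg.mpr (eps_le_one hW h0)) n
    have hr1 : (1 - eps W t₀) ^ n ≤ 1 :=
      pow_le_one₀ (sub_nonneg.mpr (eps_le_one hW h0)) (by linarith [eps_nonneg hW h0])
    have oscF : 0 ≤ hi t₀ f₀ - lo t₀ f₀ := sub_nonneg.mpr (lo_le_hi t₀ f₀)
    have oscG : 0 ≤ hi t₀ g₀ - lo t₀ g₀ := sub_nonneg.mpr (lo_le_hi t₀ g₀)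
    have oFn : 0 ≤ hi t₀ ((K D W)^[n] f₀) - lo t₀ ((K D W)^[n] f₀) := sub_nonneg.mpr (lo_le_hi t₀ _)
    have oGn : 0 ≤ hi t₀ ((K D W)^[n] g₀) - lo t₀ ((K D W)^[n] g₀) := sub_nonneg.mpr (lo_le_hi t₀ _)
    have h3 : (hi t₀ ((K D W)^[n] f₀) - lo t₀ ((K D W)^[n] f₀)) *
        (hi t₀ ((K D W)^[n] g₀) - lo t₀ ((K D W)^[n] g₀)) ≤
        (hi t₀ f₀ - lo t₀ f₀) * (hi t₀ g₀ - lo t₀ g₀) * (1 - eps W t₀) ^ n := by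
      calc (hi t₀ ((K D W)^[n] f₀) - lo t₀ ((K D W)^[n] f₀)) *
            (hi t₀ ((K D W)^[n] g₀) - lo t₀ ((K D W)^[n] g₀))
          ≤ ((1 - eps W t₀) ^ n * (hi t₀ f₀ - lo t₀ f₀)) *
            ((1 - eps W t₀) ^ n * (hi t₀ g₀ - lo t₀ g₀)) :=
            mul_le_mul oF oG oGn (mul_nonneg hr0 oscF)
        _ = (hi t₀ f₀ - lo t₀ f₀) * (hi t₀ g₀ - lo t₀ g₀) * ((1 - eps W t₀) ^ n * (1 - eps W t₀) ^ n) := by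
            ring
        _ ≤ (hi t₀ f₀ - lo t₀ f₀) * (hi t₀ g₀ - lo t₀ g₀) * (1 - eps W t₀) ^ n := by
            refine mul_le_mul_of_nonneg_left ?_ (mul_nonneg oscF oscG)
            calc (1 - eps W t₀) ^ n * (1 - eps W t₀) ^ n ≤ 1 * (1 - eps W t₀) ^ n :=
                  mul_le_mul_of_nonneg_right hr1 hr0
              _ = (1 - eps W t₀) ^ n := one_mul _
    have h4 : -(M * ((hi t₀ f₀ - lo t₀ f₀) * (hi t₀ g₀ - lo t₀ g₀)) * (1 - eps W t₀) ^ n) ≤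
        -(M * ((hi t₀ ((K D W)^[n] f₀) - lo t₀ ((K D W)^[n] f₀)) *
          (hi t₀ ((K D W)^[n] g₀) - lo t₀ ((K D W)^[n] g₀)))) := by
      rw [neg_le_neg_iff, mul_assoc]
      exact mul_le_mul_of_nonneg_left h3 hM.le
    linarith [h4, h2, h1]
  -- Archimedes
  have hpos : 0 ≤ pairSum D W f₀ g₀ := by
    by_contra hneg
    rw [not_le] at hneg
    set C : R := M * ((hi t₀ f₀ - lo t₀ f₀) * (hi t₀ g₀ - lo t₀ g₀)) with hC
    have hC0 : 0 ≤ C := mul_nonneg hM.le (mul_nonneg (sub_nonneg.mpr (lo_le_hi t₀ f₀))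
      (sub_nonneg.mpr (lo_le_hi t₀ g₀)))
    have hr : 1 - eps W t₀ < 1 := by
      linarith [div_pos h0 (sum_W_pos hW h0), show eps W t₀ = W t₀ / ∑ s, W s from rfl]
    obtain ⟨n, hn⟩ := exists_pow_lt_of_lt_one
      (div_pos (neg_pos.mpr hneg) (by linarith : (0 : R) < C + 1)) hr
    have h5 := key n
    have h6 : C * (1 - eps W t₀) ^ n ≤ (C + 1) * (1 - eps W t₀) ^ n :=
      mul_le_mul_of_nonneg_right (by linarith) (pow_nonneg (sub_nonneg.mpr (eps_le_one hW h0)) n)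
    have h7 : (C + 1) * (1 - eps W t₀) ^ n < (C + 1) * (-pairSum D W f₀ g₀ / (C + 1)) :=
      mul_lt_mul_of_pos_left hn (by linarith)
    have h8 : (C + 1) * (-pairSum D W f₀ g₀ / (C + 1)) = -pairSum D W f₀ g₀ := by
      field_simp
    linarith
  have := mul_nonneg hpos hM.le
  rw [hcov] at this
  linarith

end MarginalPA

end Summit.Ventures.PercRepro2.WForm

namespace Summit.Ventures.PercRepro2

section StatusPA

variable {V : Type*} {E : Type*} [Fintype E] [DecidableEq E] [Fintype V] [DecidableEq V]
  {R : Type*} [Field R] [LinearOrder R] [IsStrictOrderedRing R]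
variable (p : E → R) (ends : E → Sym2 V) (s : V) (T F : Finset V)

/-- `q_S = W_S · P(C(s) avoids T ∪ (S ∩ F))` — the mass of `{S₁ = S} ∩ 𝒟` for two independent copies. -/
noncomputable def statusQ (S : Finset V) : R :=
  statusW p ends s T F S * prob p (avoidAll ends s (T ∪ (S ∩ F)))

omit [LinearOrder R] [IsStrictOrderedRing R] in
/-- `statusQ` is the abstract marginal `q` of the status law. -/
lemma statusQ_eq (S : Finset V) :
    statusQ p ends s T F S =
      WForm.q (fun S S' : Finset V => Disjoint S S') (statusW p ends s T F) S := by
  unfold statusQ WForm.q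
  rw [Z_statusW_eq]

/-- **Positive association of the disjointness-conditioned status** (`E[f(S₁) g(S₁); 𝒟] · P(𝒟) ≥
E[f(S₁); 𝒟] · E[g(S₁); 𝒟]`, in the status-sum form): for all monotone `f, g : Finset V → R`,
`(∑_S q_S f S) (∑_S q_S g S) ≤ (∑_S q_S f S g S) (∑_S q_S)`. -/
theorem statusPA_of_disjoint [Archimedean R] (hp : IsProbVec p) {f g : Finset V → R}
    (hf : Monotone f) (hg : Monotone g) :
    (∑ S, statusQ p ends s T F S * f S) * (∑ S, statusQ p ends s T F S * g S) ≤
      (∑ S, statusQ p ends s T F S * (f S * g S)) * (∑ S, statusQ p ends s T F S) := by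
  simp only [statusQ_eq]
  by_cases h0 : 0 < statusW p ends s T F ∅
  · exact WForm.marginal_pa (statusW_nonneg ends s T F hp) (fun _ _ hSS' => hSS'.symm)
      (fun _ _ _ hle hd => hd.mono_left hle) ∅ (fun t => Finset.disjoint_empty_left t) h0
      (condPA_statusW p ends s T F hp) hf hg
  · -- degenerate: every `q_S` vanishes
    have hW0 : statusW p ends s T F ∅ = 0 :=
      le_antisymm (not_lt.mp h0) (statusW_nonneg ends s T F hp ∅)
    have hq : ∀ S, WForm.q (fun S S' : Finset V => Disjoint S S') (statusW p ends s T F) S = 0 := by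
      intro S
      unfold WForm.q WForm.Z
      rw [Finset.mul_sum]
      refine Finset.sum_eq_zero fun S' _ => ?_
      unfold WForm.cw
      split_ifs with hD
      · exact statusW_mul_eq_zero_of_disjoint p ends s T F hp hW0 hD.symm
      · exact mul_zero _
    simp only [hq, zero_mul, Finset.sum_const_zero, le_refl]

end StatusPA

end Summit.Ventures.PercRepro2
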